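import Literature.MathematicalPhysics.QuantumFieldTheory.Balaban1983to89.B16Sect1Backgrounds
import Literature.MathematicalPhysics.QuantumFieldTheory.Balaban1983to89.B11GaugeGlue
import Literature.MathematicalPhysics.QuantumFieldTheory.Balaban1983to89.Node00.ShearedAveragingFlat

/-!
# NODE 00 — road R0′'s row (r4) «CENTRED SHEAR»: the sheared datum of the Landau copy written with a shear NORMALISED AT THE WINDOW CENTRE, and the ABSOLUTE
# size of that shear from covariance alone — `dist1 ĝ(y) ≤ D·(v + a)` along coarse paths (the letter `σ` that every R0′ row downstream of (r0) consumes)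

Cell `pub-ymgap` (HUMAN RULINGS D-0062 ∕ D-0088), seat `pub-ymgap-dag-n07-e` g20 (R141 (C) row s3 lineage; DAG node N07 = [B11]; lane owner), 2026-08-28.  `--kind proof
--supports stmt-QuantumFields-20541` (K0⁷; count-neutral).  ITEM (r4) of the lineage's `STUB1-SECTF-MAP.md` § R0′-ASSEMBLY (LOCATED-SHEAR-SIZE, cell bus 2026-08-28).
Def-free sequel of r13 `B16Sect1Backgrounds` (`toMS`, `invG`, `iter_gaugeAct`) and of `B11GaugeGlue` §1 (the `dist1` telescope); §1–§3 are normalisation-free (covariance only);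
§4 reads the row in the letters of `Node00/ShearedAveragingFlat` (module 41): under print's normalisation (1.29) the intrinsic factor `S_j(U₁)` of (85)–(87) equals `(u↾T^{(j)})⁻¹`
(`toMS_eq_shearRIter_inv`), so the centred shear is the RELATIVE intrinsic factor `S_j(y₀)·S_j(y)⁻¹` and inherits the bound.

THE PRINT.  [B11] = T. Bałaban, *The variational problem and background fields in renormalization group method for lattice gauge theories*, Commun. Math. Phys. **102** (1985)
277–309 `[Balaban1985Variational]`, Sect. F pp. 300–304: p. 301 (152)–(153) *«Then there exists a unique gauge transformation u satisfying the restrictions ū_j = 1 on Λ′_j and such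
that Lʲη|A|, (Lʲη)²|∇A|, (Lʲη)³|∂*∂A|, (Lʲη)³|ΔA| < 9dL²B₁Mε₀ on Ω′_j, j = 0, 1, …, k; R∂^{η*}A = 0»* (for `U₁ := U′^{u⁻¹} = e^{iηA}`, `U′` the axial representative of (147)–(150));
p. 301 (151) *«|V″ − 1| < 9dL²Mε₀ ≤ c₀ on 𝔅_k»*; p. 302 (154)–(156): the constraint for `U₁` has PURE data `B = (1∕i) log V″` because print's sheared `k`-th order average (88) of
[3] = *Averaging operations for lattice gauge theories*, CMP **98** (1985) `[Balaban1985Averaging]` absorbs the gauge function `u` ((92) p. 31) and is then linearised ((157)).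
[3] (8) p. 18 `U^u(x,x′) = u(x)U(x,x′)u⁻¹(x′)`; (11) p. 19 `(Ū^u)(y,y′) = u(y)Ū(y,y′)u⁻¹(y′)` (point covariance of the averages, tree `Setup.Averaging.covariant`,
`B16Sect1Backgrounds.iter_gaugeAct`).

WHY THIS ROW (road R0′ of record, plan g83 WORDS-2, cell bus 2026-08-28 I.29399).  On R0′ the averaging of record is kept PLAIN, so the `j`-fold average of the Landau copy is the
data SHEARED by the coarse gauge function `g := u↾T^{(j)}`: `M^j(U₁)(c) = g(c₋)⁻¹·V″(c)·g(c₊)` (§1, covariance only).  Every downstream row reads the shear in LOGARITHMIC letters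
(`B‴ = log V″ − ∂_cλ + N₂`, `λ = log g`, BCH), and the non-abelian commutators make the ABSOLUTE size `σ = sup‖λ‖` load-bearing (BCH validity `‖X‖+‖B‖+‖Z‖ ≤ 1∕10`; the budget
`‖N₂‖ ≤ 8σ² + 20σv` in (164)).  Print needs no such row ((88)∕(92)∕(157)); the tree's (152) tokens bound `A`, not `u`.  THIS FILE supplies `σ` in the cheapest honest, k-uniform
way: CENTRE the shear by the constant `g₀ := g(y₀)` — `M^j(U₁)(c) = ĝ(c₋)⁻¹·V♮(c)·ĝ(c₊)` EXACTLY with `ĝ := g₀⁻¹g` (`ĝ(y₀) = 1`) and `V♮ := g₀⁻¹V″g₀` a GLOBAL conjugate of the data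
(`dist1 V♮ = dist1 V″`: every data row is invariant) — and bound `ĝ` by CHAINING the one-bond increments `dist1(g(c₋)g(c₊)⁻¹) ≤ dist1 V″(c) + dist1 M^j(U₁)(c)` (covariance + the
`dist1` triangle) along coarse lattice paths from `y₀`: `dist1 ĝ(y) ≤ n·(v + a)` for a path of `n` bonds, `v` = the data size ((151): `9dL²Mε₀`), `a` = the size of the LANDAU COPY's
level-`j` averages (at the record: dag-n07-w2's k-uniform weighted-ball bound `N07ChartRemainderP.norm_chartLog_le_weightedBall` from (152)).  Consequence for the budget: `σ♮ ≤
D·(v + a)` with `D` the coarse path-diameter of the window (≤ `d·M` for a top box of side `M`), so the quadratic remainders fit (164) under a (166)-TYPE smallness with an extra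
factor `D²` — displayed deviation (166♭) of the lineage's map; the sharp `D`-free bound under print's normalisation (1.29) needs the (78)∕(85) recursion with cubic BCH control and
is NOT attempted here.

WHAT IS PROVED (sorry-free; no definition; axioms standard; abstract `Setup` letters, ANY `GaugeGroup G`, ANY averaging family).
* §1 (r0′) ★ `iter_apply_eq_toMS_conj` — `M^j(U₁)(c) = (u↾T^{(j)})(c₋)⁻¹ · M^j(U₁^u)(c) · (u↾T^{(j)})(c₊)` for EVERY `u`, `U₁`, `j ≤ m + K` (covariance; no axial gauge, no
  normalisation); `iter_apply_eq_toMS_conj_data` (with the constraint `M^j(U₁^u)(c) = V(c)` displayed).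
* §2 ★ `shear_conj_eq_centred` (group algebra: `a⁻¹·v·b = (g₀⁻¹a)⁻¹·(g₀⁻¹vg₀)·(g₀⁻¹b)`), `dist1_const_conj` (`dist1 (g₀⁻¹vg₀) = dist1 v`), ★★ `iter_apply_eq_centredShear` (THE CENTRED
  ROW: `M^j(U₁)(c) = ĝ(c₋)⁻¹·(g₀⁻¹V(c)g₀)·ĝ(c₊)`, `ĝ := g₀⁻¹·u↾T^{(j)}`, for every constant `g₀`), `centredShear_base` (`ĝ(y₀) = 1` for `g₀ := g(y₀)`).
* §3 ★ `dist1_shear_step_le` ∕ `dist1_shear_step_le_rev` (one bond, either orientation: `a⁻¹·v·b = w → dist1(a·b⁻¹) ≤ dist1 v + dist1 w`), ★★ `dist1_toMS_path_le` (along a coarse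
  path of `n` steps each carried by a bond of either orientation with `dist1 V ≤ v`, `dist1 M^j(U₁) ≤ a` there: `dist1 (g(γ₀)·g(γₙ)⁻¹) ≤ n·(v + a)`), ★★★ `dist1_centredShear_le_of_path`
  (`dist1 ĝ(y) ≤ n·(v + a)` for a path from `y₀` to `y`), ★★ `dist1_centredShear_le_of_reach` (window form: every `y ∈ W` reachable from `y₀` in `≤ D` steps inside `W`, bounds on the
  bonds of `W` ⇒ `dist1 ĝ(y) ≤ D·(v + a)` on `W`; `_data` edition with the constraint datum `V` displayed), `dist1_centredShear_rel_le` (two window sites: `≤ 2D·(v + a)`), `dist1_centredShear_rel_eq` (`dist1 (ĝ(y)·ĝ(y′)⁻¹) = dist1 (g(y)·g(y′)⁻¹)`).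
* §4 ★★ `dist1_shearRIter_rel_le_of_path` — THE INTRINSIC EDITION: under the block axial gauges of `M^i(U₁^u)`, `i < j`, and the (81)∕(1.29) normalisation at `y₀` and `y`, the intrinsic
  factors of module 41 satisfy `dist1 (S_j(U₁)(y₀)·S_j(U₁)(y)⁻¹) ≤ n·(v + a)` along the same paths (so p609211's `λ_j = log S_j(U₁)` letters read the row directly).
HONEST SCOPE.  Exact group algebra and `dist1` triangle bookkeeping over r13 and `B11GaugeGlue` BY NAME; `v`, `a`, the window `W`, its centre `y₀` and path-diameter `D` are LETTERS
(record row: top box of `Node00.cubeDomains`, coordinate walks, `v` from (151) ∕ module 40, `a` from (152) through `norm_chartLog_le_weightedBall`, log letters `‖log ĝ‖ ≤ 2·dist1 ĝ`);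
nothing of [B11] ∕ [3] ∕ [6] analysis is asserted; the Landau copy `u` is NOT constructed ([6] Thm 2 is the route's token); BRIDGE-92-B stays GAP-STATED until rows (r1)–(r4) and their
record instances land; `stub_prop8StepCoP13` ∕ K0⁷ NOT closed; N07 NOT discharged; counts unmoved (28∕28 · 5∕27); one finite 𝕋⁴ programme at fixed ε — the route closes the conditional
finite-𝕋⁴ rung `BalabanLadder.UV` only; nothing continuum ∕ ℝ⁴ ∕ OS ∕ mass gap ∕ Clay.  No `sorry`, no `def`, no `instance`, no `notation`.

References: [B11] (147)–(158) pp. 300–302, (164)–(166) pp. 303–304; [3] (8), (11) pp. 18–19, (85)–(88), (92) p. 31; [Balaban1987RG1] (0.5)–(0.6) p. 253.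
-/

set_option autoImplicit false

namespace Literature.MathematicalPhysics.QuantumFieldTheory.Balaban1983to89.Node00

open GaugeField (gaugeAct)
open B16Sect1Backgrounds (toMS invG mulG iter_gaugeAct gaugeAct_gaugeAct)
open B11GaugeGlue (dist1_telescope_const dist1_inv_mul_eq dist1_mul_inv_comm dist1_conj_inv)
open scoped BigOperators

variable {P : Params} {G : Type*} [GaugeGroup G]

/-! ## §1  (r0′): the plain average of the Landau copy is the average of `U′ = U₁^u` conjugated by `u↾T^{(j)}` — covariance only -/

section Covariance

variable (av : ∀ i, Averaging P i G)

/-- ★ **(r0′) — the sheared datum by covariance alone** ([3] (11) iterated, r13 `iter_gaugeAct`): for EVERY gauge function `u` of `T_η`, every `U₁` and every `j ≤ m + K`,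
`M^j(U₁)(c) = (u↾T^{(j)})(c₋)⁻¹ · M^j(U₁^u)(c) · (u↾T^{(j)})(c₊)` — no axial gauge and no normalisation of `u` is used (compare module 42's (r0), which writes the same shear as the
intrinsic factor `S_j(U₁) = (u↾T^{(j)})⁻¹` under (1.29)). [cite: Balaban1985Averaging, (11) p.19; Balaban1985Variational, (154) p.302] -/
theorem iter_apply_eq_toMS_conj (u : GaugeTransf P 0 G) (U₁ : GaugeField P 0 G) {j : ℕ} (hj : j ≤ P.m + P.K) (c : PBond P j) :
    Averaging.iter av j U₁ c = (toMS u j c.src)⁻¹ * Averaging.iter av j (gaugeAct u U₁) c * toMS u j c.tgt := by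
  have hU : gaugeAct (invG u) (gaugeAct u U₁) = U₁ := by
    rw [gaugeAct_gaugeAct]
    funext b
    simp [GaugeField.gaugeAct, mulG, invG]
  conv_lhs => rw [← hU, iter_gaugeAct av (invG u) (gaugeAct u U₁) j hj]
  simp [GaugeField.gaugeAct, toMS, invG]

/-- (r0′) with the constraint datum displayed: `M^j(U₁^u)(c) = V(c)` ⇒ `M^j(U₁)(c) = g(c₋)⁻¹·V(c)·g(c₊)`, `g := u↾T^{(j)}`. [cite: Balaban1985Variational, (154)–(156) p.302] -/
theorem iter_apply_eq_toMS_conj_data (u : GaugeTransf P 0 G) (U₁ : GaugeField P 0 G) {j : ℕ} (hj : j ≤ P.m + P.K) {V : GaugeField P j G} {c : PBond P j}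
    (hV : Averaging.iter av j (gaugeAct u U₁) c = V c) :
    Averaging.iter av j U₁ c = (toMS u j c.src)⁻¹ * V c * toMS u j c.tgt := by
  rw [iter_apply_eq_toMS_conj av u U₁ hj c, hV]

end Covariance

/-! ## §2  Centring the shear at the window centre: `g = g₀·ĝ`, `ĝ(y₀) = 1`, data conjugated by the CONSTANT `g₀` -/

section Centring

/-- ★ Group algebra of the centring: `a⁻¹·v·b = (g₀⁻¹a)⁻¹ · (g₀⁻¹·v·g₀) · (g₀⁻¹b)`. [cite: Balaban1987RG1, (0.6) p.253 (bookkeeping)] -/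
theorem shear_conj_eq_centred (g₀ a b v : G) : a⁻¹ * v * b = (g₀⁻¹ * a)⁻¹ * (g₀⁻¹ * v * g₀) * (g₀⁻¹ * b) := by
  group

/-- A GLOBAL conjugation does not change sizes: `dist1 (g₀⁻¹·v·g₀) = dist1 v` (every data row of the lineage is a `dist1`∕norm row).  (The same one-liner is the Summits-side
`Summit.QuantumFields.BalabanUV.T4Continuum.NE7b.BoxNearFlatFilling.dist1_inv_mul_mul`, not importable into `Literature`; restated from `GaugeGroup.dist1_conj`.)
[cite: Balaban1985Variational, (151) p.301 (bookkeeping)] -/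
theorem dist1_const_conj (g₀ v : G) : dist1 (g₀⁻¹ * v * g₀) = dist1 v :=
  dist1_conj_inv v g₀

variable (av : ∀ i, Averaging P i G)

/-- ★★ **THE CENTRED ROW (r4, identity half)**: for every constant `g₀ ∈ G` (at the record: `g₀ := u(emb_j y₀)`, `y₀` the window centre),
`M^j(U₁)(c) = ĝ(c₋)⁻¹ · (g₀⁻¹·V(c)·g₀) · ĝ(c₊)` with `ĝ := g₀⁻¹·u↾T^{(j)}` — the PLAIN average of the Landau copy is a GLOBAL conjugate of the data sheared by the CENTRED coarse
gauge function. [cite: Balaban1985Variational, (154)–(156) p.302] -/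
theorem iter_apply_eq_centredShear (u : GaugeTransf P 0 G) (U₁ : GaugeField P 0 G) {j : ℕ} (hj : j ≤ P.m + P.K) {V : GaugeField P j G} {c : PBond P j}
    (hV : Averaging.iter av j (gaugeAct u U₁) c = V c) (g₀ : G) :
    Averaging.iter av j U₁ c = (g₀⁻¹ * toMS u j c.src)⁻¹ * (g₀⁻¹ * V c * g₀) * (g₀⁻¹ * toMS u j c.tgt) := by
  rw [iter_apply_eq_toMS_conj_data av u U₁ hj hV]
  exact shear_conj_eq_centred g₀ _ _ _

/-- The centred shear is `1` at the centre: `g₀ := g(y₀)` ⇒ `ĝ(y₀) = g₀⁻¹·g(y₀) = 1`. [cite: Balaban1985Variational, (152) p.301 (bookkeeping)] -/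
theorem centredShear_base (g : GaugeTransf P 0 G) (j : ℕ) (y₀ : Site P j) : (toMS g j y₀)⁻¹ * toMS g j y₀ = 1 :=
  inv_mul_cancel _

end Centring

/-! ## §3  The size of the centred shear from covariance: one-bond increments and chains along coarse paths -/

section Size

/-- ★ **One-bond increment**: if `a⁻¹·v·b = w` (the relation `g(c₋)⁻¹·V″(c)·g(c₊) = M^j(U₁)(c)` at a bond), then `dist1 (a·b⁻¹) ≤ dist1 v + dist1 w` — since
`a·b⁻¹ = v·(b·w⁻¹·b⁻¹)`; the `dist1` triangle with conjugation and inversion invariance (`B11GaugeGlue.dist1_trans_mul_inv_le` in hypothesis form). [cite: Balaban1985Variational, (151)–(152) p.301] -/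
theorem dist1_shear_step_le {a b v w : G} (h : a⁻¹ * v * b = w) : dist1 (a * b⁻¹) ≤ dist1 v + dist1 w := by
  have hv : v = a * w * b⁻¹ := by rw [← h]; group
  have hab : a * b⁻¹ = v * (b * w⁻¹ * b⁻¹) := by rw [hv]; group
  rw [hab]
  refine (GaugeGroup.dist1_mul_le _ _).trans ?_
  rw [GaugeGroup.dist1_conj, GaugeGroup.dist1_inv]

/-- The increment read across a bond traversed BACKWARDS: `b⁻¹·v·a = w` ⇒ `dist1 (a·b⁻¹) ≤ dist1 v + dist1 w`. [cite: Balaban1985Variational, (151)–(152) p.301] -/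
theorem dist1_shear_step_le_rev {a b v w : G} (h : b⁻¹ * v * a = w) : dist1 (a * b⁻¹) ≤ dist1 v + dist1 w := by
  rw [← dist1_mul_inv_comm]
  exact dist1_shear_step_le h

variable (av : ∀ i, Averaging P i G)

/-- ★★ **Chain along a coarse path**: let `γ₀, …, γₙ` be sites of `T^{(j)}` such that each step `(γᵢ, γᵢ₊₁)` is carried by a bond `c` of either orientation at which the data and the
average of the Landau copy are small, `dist1 M^j(U₁^u)(c) ≤ v` and `dist1 M^j(U₁)(c) ≤ a`; then the shear `g := u↾T^{(j)}` is within `n·(v + a)` of a constant along the path: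
`dist1 (g(γ₀)·g(γₙ)⁻¹) ≤ n·(v + a)` (`B11GaugeGlue.dist1_telescope_const` + §3's increments + §1's covariance). [cite: Balaban1985Variational, (151)–(152) p.301] -/
theorem dist1_toMS_path_le (u : GaugeTransf P 0 G) (U₁ : GaugeField P 0 G) {j : ℕ} (hj : j ≤ P.m + P.K) (γ : ℕ → Site P j) (n : ℕ) (v a : ℝ)
    (hγ : ∀ i, i < n → ∃ c : PBond P j, ((c.src = γ i ∧ c.tgt = γ (i + 1)) ∨ (c.src = γ (i + 1) ∧ c.tgt = γ i)) ∧
      dist1 (Averaging.iter av j (gaugeAct u U₁) c) ≤ v ∧ dist1 (Averaging.iter av j U₁ c) ≤ a) :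
    dist1 (toMS u j (γ 0) * (toMS u j (γ n))⁻¹) ≤ n * (v + a) := by
  refine dist1_telescope_const (fun i => toMS u j (γ i)) n (v + a) fun i hi => ?_
  obtain ⟨c, hc, hv, ha⟩ := hγ i hi
  have hrel := iter_apply_eq_toMS_conj av u U₁ hj c
  rcases hc with ⟨hs, ht⟩ | ⟨hs, ht⟩
  · rw [hs, ht] at hrel
    exact (dist1_shear_step_le hrel.symm).trans (add_le_add hv ha)
  · rw [hs, ht] at hrel
    exact (dist1_shear_step_le_rev hrel.symm).trans (add_le_add hv ha)

/-- ★★★ **ROW (r4) — THE SIZE OF THE CENTRED SHEAR along a path**: for a coarse path of `n` steps from the centre `y₀` to `y` as in `dist1_toMS_path_le`,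
`dist1 ĝ(y) = dist1 (g(y₀)⁻¹·g(y)) ≤ n·(v + a)`. [cite: Balaban1985Variational, (151)–(152) p.301] -/
theorem dist1_centredShear_le_of_path (u : GaugeTransf P 0 G) (U₁ : GaugeField P 0 G) {j : ℕ} (hj : j ≤ P.m + P.K) (γ : ℕ → Site P j) (n : ℕ) (v a : ℝ)
    (hγ : ∀ i, i < n → ∃ c : PBond P j, ((c.src = γ i ∧ c.tgt = γ (i + 1)) ∨ (c.src = γ (i + 1) ∧ c.tgt = γ i)) ∧
      dist1 (Averaging.iter av j (gaugeAct u U₁) c) ≤ v ∧ dist1 (Averaging.iter av j U₁ c) ≤ a)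
    {y₀ y : Site P j} (h0 : γ 0 = y₀) (hn : γ n = y) :
    dist1 ((toMS u j y₀)⁻¹ * toMS u j y) ≤ n * (v + a) := by
  rw [dist1_inv_mul_eq, ← h0, ← hn]
  exact dist1_toMS_path_le av u U₁ hj γ n v a hγ

/-- ★★ **ROW (r4), window form**: if every site of the window `W ⊆ T^{(j)}` is reached from the centre `y₀` by a coarse path of at most `D` steps whose carrying bonds have both ends
in `W`, and on every bond with both ends in `W` the data and the Landau copy's average are small (`≤ v`, `≤ a`), then the centred shear is uniformly small on the window:
`dist1 (g(y₀)⁻¹·g(y)) ≤ D·(v + a)` for all `y ∈ W`. [cite: Balaban1985Variational, (151)–(152) p.301] -/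
theorem dist1_centredShear_le_of_reach (u : GaugeTransf P 0 G) (U₁ : GaugeField P 0 G) {j : ℕ} (hj : j ≤ P.m + P.K) (W : Set (Site P j)) (y₀ : Site P j) (D : ℕ)
    {v a : ℝ} (hv0 : 0 ≤ v) (ha0 : 0 ≤ a)
    (hv : ∀ c : PBond P j, c.src ∈ W → c.tgt ∈ W → dist1 (Averaging.iter av j (gaugeAct u U₁) c) ≤ v)
    (ha : ∀ c : PBond P j, c.src ∈ W → c.tgt ∈ W → dist1 (Averaging.iter av j U₁ c) ≤ a)
    (hreach : ∀ y ∈ W, ∃ n ≤ D, ∃ γ : ℕ → Site P j, γ 0 = y₀ ∧ γ n = y ∧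
      ∀ i, i < n → ∃ c : PBond P j, ((c.src = γ i ∧ c.tgt = γ (i + 1)) ∨ (c.src = γ (i + 1) ∧ c.tgt = γ i)) ∧ c.src ∈ W ∧ c.tgt ∈ W)
    {y : Site P j} (hy : y ∈ W) :
    dist1 ((toMS u j y₀)⁻¹ * toMS u j y) ≤ D * (v + a) := by
  obtain ⟨n, hnD, γ, h0, hn, hsteps⟩ := hreach y hy
  have hpath := dist1_centredShear_le_of_path av u U₁ hj γ n v a (fun i hi => ?_) h0 hn
  · refine hpath.trans ?_
    have hva : 0 ≤ v + a := add_nonneg hv0 ha0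
    exact mul_le_mul_of_nonneg_right (by exact_mod_cast hnD) hva
  · obtain ⟨c, hc, hcs, hct⟩ := hsteps i hi
    exact ⟨c, hc, hv c hcs hct, ha c hcs hct⟩

/-- Window form with the constraint datum DISPLAYED as a field `V` on the window's bonds (`M^j(U₁^u)(c) = V(c)` there — at the record `V = V″` of (149)–(151)):
`dist1 V ≤ v` and `dist1 M^j(U₁) ≤ a` on the bonds of `W` ⇒ `dist1 (g(y₀)⁻¹·g(y)) ≤ D·(v + a)` on `W`. [cite: Balaban1985Variational, (151)–(152) p.301] -/
theorem dist1_centredShear_le_of_reach_data (u : GaugeTransf P 0 G) (U₁ : GaugeField P 0 G) {j : ℕ} (hj : j ≤ P.m + P.K) (W : Set (Site P j)) (y₀ : Site P j) (D : ℕ)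
    {V : GaugeField P j G} (hV : ∀ c : PBond P j, c.src ∈ W → c.tgt ∈ W → Averaging.iter av j (gaugeAct u U₁) c = V c)
    {v a : ℝ} (hv0 : 0 ≤ v) (ha0 : 0 ≤ a)
    (hv : ∀ c : PBond P j, c.src ∈ W → c.tgt ∈ W → dist1 (V c) ≤ v)
    (ha : ∀ c : PBond P j, c.src ∈ W → c.tgt ∈ W → dist1 (Averaging.iter av j U₁ c) ≤ a)
    (hreach : ∀ y ∈ W, ∃ n ≤ D, ∃ γ : ℕ → Site P j, γ 0 = y₀ ∧ γ n = y ∧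
      ∀ i, i < n → ∃ c : PBond P j, ((c.src = γ i ∧ c.tgt = γ (i + 1)) ∨ (c.src = γ (i + 1) ∧ c.tgt = γ i)) ∧ c.src ∈ W ∧ c.tgt ∈ W)
    {y : Site P j} (hy : y ∈ W) :
    dist1 ((toMS u j y₀)⁻¹ * toMS u j y) ≤ D * (v + a) :=
  dist1_centredShear_le_of_reach av u U₁ hj W y₀ D hv0 ha0 (fun c hs ht => by rw [hV c hs ht]; exact hv c hs ht) ha hreach hy

/-- The RELATIVE shear of two window sites does not see the centre: `dist1 (ĝ(y)·ĝ(y′)⁻¹) = dist1 (g(y)·g(y′)⁻¹) ≤ 2D·(v + a)`. [cite: Balaban1985Variational, (151)–(152) p.301] -/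
theorem dist1_centredShear_rel_le (u : GaugeTransf P 0 G) (U₁ : GaugeField P 0 G) {j : ℕ} (hj : j ≤ P.m + P.K) (W : Set (Site P j)) (y₀ : Site P j) (D : ℕ)
    {v a : ℝ} (hv0 : 0 ≤ v) (ha0 : 0 ≤ a)
    (hv : ∀ c : PBond P j, c.src ∈ W → c.tgt ∈ W → dist1 (Averaging.iter av j (gaugeAct u U₁) c) ≤ v)
    (ha : ∀ c : PBond P j, c.src ∈ W → c.tgt ∈ W → dist1 (Averaging.iter av j U₁ c) ≤ a)
    (hreach : ∀ y ∈ W, ∃ n ≤ D, ∃ γ : ℕ → Site P j, γ 0 = y₀ ∧ γ n = y ∧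
      ∀ i, i < n → ∃ c : PBond P j, ((c.src = γ i ∧ c.tgt = γ (i + 1)) ∨ (c.src = γ (i + 1) ∧ c.tgt = γ i)) ∧ c.src ∈ W ∧ c.tgt ∈ W)
    {y y' : Site P j} (hy : y ∈ W) (hy' : y' ∈ W) :
    dist1 (((toMS u j y₀)⁻¹ * toMS u j y) * ((toMS u j y₀)⁻¹ * toMS u j y')⁻¹) ≤ 2 * D * (v + a) := by
  have h1 := dist1_centredShear_le_of_reach av u U₁ hj W y₀ D hv0 ha0 hv ha hreach hy
  have h2 := dist1_centredShear_le_of_reach av u U₁ hj W y₀ D hv0 ha0 hv ha hreach hy'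
  calc dist1 (((toMS u j y₀)⁻¹ * toMS u j y) * ((toMS u j y₀)⁻¹ * toMS u j y')⁻¹)
      ≤ dist1 ((toMS u j y₀)⁻¹ * toMS u j y) + dist1 ((toMS u j y₀)⁻¹ * toMS u j y')⁻¹ := GaugeGroup.dist1_mul_le _ _
    _ = dist1 ((toMS u j y₀)⁻¹ * toMS u j y) + dist1 ((toMS u j y₀)⁻¹ * toMS u j y') := by rw [GaugeGroup.dist1_inv]
    _ ≤ D * (v + a) + D * (v + a) := add_le_add h1 h2
    _ = 2 * D * (v + a) := by ring

/-- The relative shear written without the centre: `ĝ(y)·ĝ(y′)⁻¹ = g₀⁻¹·(g(y)·g(y′)⁻¹)·g₀`, so `dist1 (ĝ(y)·ĝ(y′)⁻¹) = dist1 (g(y)·g(y′)⁻¹)`. [cite: Balaban1985Variational, (152) p.301 (bookkeeping)] -/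
theorem dist1_centredShear_rel_eq (g₀ a b : G) : dist1 ((g₀⁻¹ * a) * (g₀⁻¹ * b)⁻¹) = dist1 (a * b⁻¹) := by
  have h : (g₀⁻¹ * a) * (g₀⁻¹ * b)⁻¹ = g₀⁻¹ * (a * b⁻¹) * g₀ := by group
  rw [h, dist1_conj_inv]

end Size

/-! ## §4  The intrinsic edition: under (1.29) the centred shear is the relative intrinsic factor `S_j(y₀)·S_j(y)⁻¹` of module 41 -/

section Intrinsic

variable (av : ∀ i, Averaging P i G) (cd : ∀ i, ContourData P i G) (𝓔 : ∀ i, Site P (i+1) → (Site P i → G) → G)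

/-- Under the (81)∕(1.29) normalisation at `y₀` and `y` (and the axial gauges below level `j`), the centred shear IS the relative intrinsic factor:
`g(y₀)⁻¹·g(y) = S_j(U₁)(y₀)·S_j(U₁)(y)⁻¹` (module 41's (87) `toMS_eq_shearRIter_inv` at both sites). [cite: Balaban1985Averaging, (87) p.31; Balaban1985Variational, (152) p.301] -/
theorem centredShear_eq_shearRIter_rel
    (h𝓔 : ∀ (i : ℕ) (y : Site P (i+1)) (f f' : Site P i → G), (∀ x, blockOf x = y → f x = f' x) → 𝓔 i y f = 𝓔 i y f')
    (hctr : ∀ (i : ℕ) (U : GaugeField P i G) (y : Site P (i+1)), (cd i).holTo U y (emb y) = 1)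
    {u : GaugeTransf P 0 G} {U₁ : GaugeField P 0 G} {j : ℕ} (hj : j ≤ P.m + P.K)
    (hax : ∀ i < j, AxialGauge (cd i) (Averaging.iter av i (gaugeAct u U₁))) {y₀ y : Site P j}
    (h0 : gaugeAvgIter 𝓔 u j y₀ = 1) (hy : gaugeAvgIter 𝓔 u j y = 1) :
    (toMS u j y₀)⁻¹ * toMS u j y = shearRIter av cd 𝓔 U₁ j y₀ * (shearRIter av cd 𝓔 U₁ j y)⁻¹ := by
  rw [toMS_eq_shearRIter_inv av cd 𝓔 h𝓔 hctr hj hax h0, toMS_eq_shearRIter_inv av cd 𝓔 h𝓔 hctr hj hax hy, inv_inv]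

/-- ★★ **ROW (r4), intrinsic edition**: along a coarse path of `n` steps from `y₀` to `y` carried by bonds where the data `M^j(U₁^u)` and the averages `M^j(U₁)` are small (`≤ v`, `≤ a`),
and under the normalisation at the two END sites only, the intrinsic factors of [3] (85) are covariantly almost constant: `dist1 (S_j(U₁)(y₀)·S_j(U₁)(y)⁻¹) ≤ n·(v + a)` — the
absolute size of p609211's `λ_j = log S_j(U₁)` letters once `S_j(y₀)` is factored out as the global constant of §2. [cite: Balaban1985Averaging, (85)–(87) p.31; Balaban1985Variational, (151)–(152) p.301] -/
theorem dist1_shearRIter_rel_le_of_path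
    (h𝓔 : ∀ (i : ℕ) (y : Site P (i+1)) (f f' : Site P i → G), (∀ x, blockOf x = y → f x = f' x) → 𝓔 i y f = 𝓔 i y f')
    (hctr : ∀ (i : ℕ) (U : GaugeField P i G) (y : Site P (i+1)), (cd i).holTo U y (emb y) = 1)
    {u : GaugeTransf P 0 G} {U₁ : GaugeField P 0 G} {j : ℕ} (hj : j ≤ P.m + P.K)
    (hax : ∀ i < j, AxialGauge (cd i) (Averaging.iter av i (gaugeAct u U₁))) (γ : ℕ → Site P j) (n : ℕ) (v a : ℝ)
    (hγ : ∀ i, i < n → ∃ c : PBond P j, ((c.src = γ i ∧ c.tgt = γ (i + 1)) ∨ (c.src = γ (i + 1) ∧ c.tgt = γ i)) ∧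
      dist1 (Averaging.iter av j (gaugeAct u U₁) c) ≤ v ∧ dist1 (Averaging.iter av j U₁ c) ≤ a)
    {y₀ y : Site P j} (hγ0 : γ 0 = y₀) (hγn : γ n = y) (h0 : gaugeAvgIter 𝓔 u j y₀ = 1) (hy : gaugeAvgIter 𝓔 u j y = 1) :
    dist1 (shearRIter av cd 𝓔 U₁ j y₀ * (shearRIter av cd 𝓔 U₁ j y)⁻¹) ≤ n * (v + a) := by
  rw [← centredShear_eq_shearRIter_rel av cd 𝓔 h𝓔 hctr hj hax h0 hy]
  exact dist1_centredShear_le_of_path av u U₁ hj γ n v a hγ hγ0 hγn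

end Intrinsic

end Literature.MathematicalPhysics.QuantumFieldTheory.Balaban1983to89.Node00
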